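import Mathlib
import HarnessLib
import Summits.Ventures.LatticeQCDFlow.Scoring.RegenerativeCLT

/-!
# Strong consistency of the regenerative estimator: `Â_R → π(f)` almost surely, from any start

HONEST FRAMING: exact (Metropolis-corrected) sampling algorithms for lattice gauge theory;
figures of merit are autocorrelation/cost numbers at stated couplings and volumes; no
continuum-physics claim.

Venture `LatticeQCDFlow` (cell pub-lqcd), topic `Scoring`; FANOUT row 8 (`s0-cpn-nemc`, GEN-18).
NEW WORK of the cell, not a published result; no definition is introduced.  Notation of
`Scoring/RegenerativeCLT.lean`.  The tour pairs are i.i.d. (`Scoring/SplitChainTourIID.lean`), so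
Mathlib's strong law (`ProbabilityTheory.strong_law_ae_real`) gives, from ANY initial law,
`Σ_{i<R} Y_{i+1}/R → E_ν̂[Y_0] = π(f)/e` (cycle formula, `Scoring/SplitChainCycleFormula.lean`) and
`Σ_{i<R} N_{i+1}/R → 1/e` almost surely; the quotient is the tour estimator, hence
`Â_R → π(f)` almost surely — strong consistency of the regenerative estimator, the almost-sure
companion of the CLT of the parent file.  Printed counterpart NAMED ONLY: the ratio-estimator
strong law of regenerative simulation (Crane–Iglehart 1975; Mykland–Tierney–Yu 1995 §3) — nothing
is cited as a fact.

## Content (`π` invariant, `0 < ε < 1`, `|f| ≤ C` measurable, any initial law, `e = ε.toReal`)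

* **`splitChain_tourSum_strongLaw`** — `Σ_{i<R} Y_{i+1} / R → π(f) / e` almost surely;
* **`regenerative_estimator_strongLaw`** — `Â_R = Σ Y_{i+1} / Σ N_{i+1} → π(f)` almost surely.

NOT CLAIMED: a rate (law of the iterated logarithm); unbounded `f`; any `ε` of a concrete sampler.
-/

noncomputable section

namespace Summit.Ventures.LatticeQCDFlow.Scoring

open MeasureTheory ProbabilityTheory Filter Finset Preorder Literature.Probability.MarkovChains
open scoped ENNReal Topology

section StrongLaw

variable {Ω : Type*} [MeasurableSpace Ω]
  {κ : Kernel Ω Ω} [IsMarkovKernel κ] {ν : Measure Ω} [IsProbabilityMeasure ν] {ε : ℝ≥0∞}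
  {hmin : ∀ x {B : Set Ω}, MeasurableSet B → ε * ν B ≤ κ x B}
  (κs : Kernel (Ω × Bool) (Ω × Bool)) [IsMarkovKernel κs]
  (μs : Measure (Ω × Bool)) [IsProbabilityMeasure μs]

/-- **STRONG LAW FOR THE TOUR SUMS**: `π` invariant, `0 < ε < 1`, `|f| ≤ C` measurable, any
initial law: `Σ_{i<R} Y_{i+1} / R → π(f)/e` almost surely. -/
theorem splitChain_tourSum_strongLaw {π : Measure Ω} [IsProbabilityMeasure π]
    (hπ : Kernel.Invariant κ π) (hε0 : 0 < ε) (hε : ε < 1)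
    (hκs : ∀ p, κs p = (ε • ν).map (fun y : Ω => (y, true))
      + ((1 - ε) • Doeblin.residualKernel κ ν ε hmin p.1).map (fun y : Ω => (y, false)))
    {f : Ω → ℝ} (hf : Measurable f) {C : ℝ} (hC : ∀ x, |f x| ≤ C) :
    ∀ᵐ x ∂(Kernel.trajMeasure (X := fun _ : ℕ => Ω × Bool) μs
        (fun m : ℕ => κs.comap (fun h : (i : ↥(Finset.Iic m)) → Ω × Bool =>
          h ⟨m, Finset.mem_Iic.2 le_rfl⟩) (measurable_pi_apply _))),
      Tendsto (fun R : ℕ => (∑ i ∈ Finset.range R, (∑' u, (if (∑ s ∈ Finset.range u, (if (x (s + 1)).2 then (1 : ℕ) else 0)) = i + 1 then (1 : ℝ) else 0) * f (x u).1)) / R) atTop (𝓝 ((∫ z, f z ∂π) / ε.toReal)) := by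
  haveI hνt : IsProbabilityMeasure (ν.map (fun y : Ω => (y, true))) :=
    Measure.isProbabilityMeasure_map (measurable_tagCoin true).aemeasurable
  set P := (Kernel.trajMeasure (X := fun _ : ℕ => Ω × Bool) μs
        (fun m : ℕ => κs.comap (fun h : (i : ↥(Finset.Iic m)) → Ω × Bool =>
          h ⟨m, Finset.mem_Iic.2 le_rfl⟩) (measurable_pi_apply _))) with hP
  -- the tour sums as first coordinates of the i.i.d. tour pairs `(S^f_{i+1}, S^1_{i+1})`
  have hT := splitChain_tourPairs_iIndepFun κs μs (κ := κ) (ν := ν) (hmin := hmin) hε0 hε hκs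
    (g₁ := f) (g₂ := fun _ => (1 : ℝ)) hf measurable_const
  have hTid := fun i => splitChain_tourPair_identDistrib κs μs (κ := κ) (ν := ν) (hmin := hmin) hε0
    hε hκs (g₁ := f) (g₂ := fun _ => (1 : ℝ)) hf measurable_const i
  have hT0 := splitChain_tourPair_identDistrib_fresh κs μs (κ := κ) (ν := ν) (hmin := hmin) hε0 hε
    hκs (g₁ := f) (g₂ := fun _ => (1 : ℝ)) hf measurable_const 0
  rw [← hP] at hT hTid hT0
  have hX := hT.comp (fun _ => Prod.fst) (fun _ => measurable_fst)
  have hXid := fun i => (hTid i).comp measurable_fst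
  have hX0 := hT0.comp measurable_fst
  simp only [Function.comp_def, Nat.zero_add] at hX hXid hX0
  -- integrability and mean of `Y_1` via the fresh first tour (cycle formula)
  obtain ⟨hI0, hE0⟩ := splitChain_fresh_integral_tourSum κs (κ := κ) (ν := ν) (hmin := hmin) hπ hε0
    hε hκs hf hC
  have hI1 : Integrable (fun x : ℕ → Ω × Bool => (∑' u, (if (∑ s ∈ Finset.range u, (if (x (s + 1)).2 then (1 : ℕ) else 0)) = 1 then (1 : ℝ) else 0) * f (x u).1)) P :=
    (hX0.integrable_iff).2 hI0
  have hE1 : ∫ x, (∑' u, (if (∑ s ∈ Finset.range u, (if (x (s + 1)).2 then (1 : ℕ) else 0)) = 1 then (1 : ℝ) else 0) * f (x u).1) ∂P = (∫ z, f z ∂π) / ε.toReal := by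
    rw [hX0.integral_eq]; exact hE0
  have hslln := strong_law_ae_real (fun (i : ℕ) (x : ℕ → Ω × Bool) => (∑' u, (if (∑ s ∈ Finset.range u, (if (x (s + 1)).2 then (1 : ℕ) else 0)) = i + 1 then (1 : ℝ) else 0) * f (x u).1)) hI1
    (fun i j hij => hX.indepFun hij) hXid
  rw [hE1] at hslln
  exact hslln

/-- **STRONG CONSISTENCY OF THE REGENERATIVE ESTIMATOR**: `π` invariant, `0 < ε < 1`, `|f| ≤ C`
measurable, any initial law: `Â_R = Σ_{i<R} Y_{i+1} / Σ_{i<R} N_{i+1} → π(f)` almost surely. -/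
theorem regenerative_estimator_strongLaw {π : Measure Ω} [IsProbabilityMeasure π]
    (hπ : Kernel.Invariant κ π) (hε0 : 0 < ε) (hε : ε < 1)
    (hκs : ∀ p, κs p = (ε • ν).map (fun y : Ω => (y, true))
      + ((1 - ε) • Doeblin.residualKernel κ ν ε hmin p.1).map (fun y : Ω => (y, false)))
    {f : Ω → ℝ} (hf : Measurable f) {C : ℝ} (hC : ∀ x, |f x| ≤ C) :
    ∀ᵐ x ∂(Kernel.trajMeasure (X := fun _ : ℕ => Ω × Bool) μs
        (fun m : ℕ => κs.comap (fun h : (i : ↥(Finset.Iic m)) → Ω × Bool =>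
          h ⟨m, Finset.mem_Iic.2 le_rfl⟩) (measurable_pi_apply _))),
      Tendsto (fun R : ℕ => (∑ i ∈ Finset.range R, (∑' u, (if (∑ s ∈ Finset.range u, (if (x (s + 1)).2 then (1 : ℕ) else 0)) = i + 1 then (1 : ℝ) else 0) * f (x u).1)) / (∑ i ∈ Finset.range R, (∑' u, (if (∑ s ∈ Finset.range u, (if (x (s + 1)).2 then (1 : ℕ) else 0)) = i + 1 then (1 : ℝ) else 0)))) atTop (𝓝 (∫ z, f z ∂π)) := by
  have he0 : 0 < ε.toReal := ENNReal.toReal_pos hε0.ne' (ne_top_of_lt hε)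
  filter_upwards [splitChain_tourSum_strongLaw κs μs (κ := κ) (ν := ν) (hmin := hmin) hπ hε0 hε hκs
    hf hC, splitChain_tourLength_strongLaw κs μs (κ := κ) (ν := ν) (hmin := hmin) hε0 hε hκs]
    with x hY hN
  have hlim : Tendsto (fun R : ℕ => ((∑ i ∈ Finset.range R, (∑' u, (if (∑ s ∈ Finset.range u, (if (x (s + 1)).2 then (1 : ℕ) else 0)) = i + 1 then (1 : ℝ) else 0) * f (x u).1)) / R) / ((∑ i ∈ Finset.range R, (∑' u, (if (∑ s ∈ Finset.range u, (if (x (s + 1)).2 then (1 : ℕ) else 0)) = i + 1 then (1 : ℝ) else 0))) / R)) atTop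
      (𝓝 ((∫ z, f z ∂π) / ε.toReal / (1 / ε.toReal))) :=
    hY.div hN (by positivity)
  have hc : (∫ z, f z ∂π) / ε.toReal / (1 / ε.toReal) = ∫ z, f z ∂π := by
    field_simp
  rw [hc] at hlim
  refine hlim.congr' ?_
  filter_upwards [eventually_gt_atTop 0] with R hR
  have hR0 : (R : ℝ) ≠ 0 := (Nat.cast_pos.2 hR).ne'
  rw [div_div_div_cancel_right₀ hR0]

end StrongLaw

end Summit.Ventures.LatticeQCDFlow.Scoring

end
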